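import Summits.AtomisticToContinuum.HydrodynamicLimit.Theorems.CollisionIsometryCLTCollisionalTransferLocalityTimeIntegralInProbability
import Summits.AtomisticToContinuum.HydrodynamicLimit.Theorems.CollisionIsometryCLTCollisionalTransferLocalityFlowMeasurable
import Summits.AtomisticToContinuum.HydrodynamicLimit.Theorems.CollisionIsometryCLTCollisionalTransferLocalityStreamingDerivative
import Summits.AtomisticToContinuum.HydrodynamicLimit.Theorems.CollisionIsometryCLTCollisionalTransferLocalityObsLLN
import Summits.AtomisticToContinuum.HydrodynamicLimit.Theorems.CollisionIsometryCLTCollisionalTransferLocalityStreamLLN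
import Summits.AtomisticToContinuum.HydrodynamicLimit.Theorems.CollisionIsometryCLTCollisionalTransferLocalityDivergenceZero
import Summits.AtomisticToContinuum.HydrodynamicLimit.Theorems.CollisionIsometryCLTCollisionalTransferLocalitySliceFTC
import Summits.AtomisticToContinuum.HydrodynamicLimit.Theorems.CollisionIsometryCLTCollisionalTransferLocalityTimeDerivBounds
import Summits.AtomisticToContinuum.HydrodynamicLimit.Theorems.CollisionIsometryCLTCollisionalTransferLocalityVelocityAverages
import Summits.AtomisticToContinuum.HydrodynamicLimit.Theorems.JParityClosureOddContactSymmetryGibbsInvariance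
import HarnessLib

/-!
# The time-integral part of the equilibrium rung of the crux (line `hemisphere-affine-slaving`)

Helper file (`--supports stmt-AtomisticToContinuum-9518`, line `hemisphere-affine-slaving`, skeleton
v10.1, stub `cc_timeIntegral_tendsto_const`) for the crux `CollisionalTransferLocality`. Under the
HOMOGENEOUS local Gibbs law `G_N` (activity `1`, mean velocity `0`, temperature `θ > 0`, reduced
density `σ ≤ 1/2`) the time-integral part of the crux's residual,
`I_N(z, τ) = ∫₀^τ [O_{∂ψ,∂χ}(s, Φ_s z) + d/dr|₀ O(s, S_r Φ_s z)] ds`, concentrates at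
`(3θ/2)(∫ χ_τ − ∫ χ_0)` as `N → ∞`, for every `τ ∈ [0, t]`:
* the integrand is a one-particle empirical average `(N+1)⁻¹ Σᵢ Z(s, (Φ_s z)ᵢ)` of an explicit
  `Z(s, x, v)` (`deriv_Obs_freeFlight_eq`), with weights `∂ₛψ, ∂ₛχ, ∇ψ, ∇χ` jointly continuous and
  bounded on `[0, t] × 𝕋³` (extended to all times through `projIcc`) and cubic velocity tails;
* centred at `ℓ(s) = (3θ/2) ∫ ∂ₛχ(s, ·)`, its one-time slices tend to `0` in probability (static
  laws of large numbers `obs_lln_const`, `stream_lln_const`, `∫ Σ_a ∂_aψ_a = 0`, transported along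
  the flow by STATIONARITY of the homogeneous law), with second moments bounded in `(N, s)`;
* the time-integral lemma `tendsto_measure_setIntegral_of_forall` (through the jointly measurable
  modification of the flow `exists_measurable_flow`) and `∫₀^τ ℓ = (3θ/2)(∫ χ_τ − ∫ χ_0)` conclude.
Everything is folklore probability and calculus; nothing is cited.
-/

namespace Summit.AtomisticToContinuum.HydrodynamicLimit.Theorems.HemisphereAffineSlaving

open scoped BigOperators Topology Classical ENNReal InnerProductSpace
open Filter Set Function MeasureTheory
open Literature.Analysis.FunctionSpaces Literature.Analysis.FluidPDE

noncomputable section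

open Literature.MathematicalPhysics.KineticTheory (T3 V3)
open Literature.MathematicalPhysics.KineticTheory (localGibbsLaw gaussMeasure empiricalDensityField)

/-! ### Generic measure theory -/

/-- A jointly measurable process whose slices on `[0, τ]` are square integrable with second
moments bounded uniformly in time has, almost surely, time-integrable paths on `[0, τ]`
(Tonelli and the truncation bound `E|X_s| ≤ 2 + C`). [folklore] -/
theorem ae_integrableOn_Icc_of_sq_le {Ω : Type} [MeasurableSpace Ω] (P : Measure Ω)
    [IsProbabilityMeasure P] {τ : ℝ} {X : ℝ → Ω → ℝ} (hXm : Measurable (uncurry X))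
    (hL2 : ∀ s ∈ Icc 0 τ, MemLp (X s) 2 P) {C : ℝ} (hC : ∀ s ∈ Icc 0 τ, ∫ ω, X s ω ^ 2 ∂P ≤ C) :
    ∀ᵐ ω ∂P, IntegrableOn (fun s => X s ω) (Icc 0 τ) := by
  have hF_meas : Measurable fun ω => ∫⁻ s in Icc 0 τ, ‖X s ω‖ₑ := hXm.enorm.lintegral_prod_left
  have hfin : ∫⁻ ω, (∫⁻ s in Icc 0 τ, ‖X s ω‖ₑ) ∂P ≠ ∞ := by
    rw [lintegral_lintegral_swap ((hXm.comp measurable_swap).enorm.aemeasurable)]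
    refine ne_of_lt (lt_of_le_of_lt (setLIntegral_mono (g := fun _ => 1 + 1 + .ofReal (C / 1))
      measurable_const fun s hs => ?_)
      (by rw [setLIntegral_const]; exact ENNReal.mul_lt_top (by simp) measure_Icc_lt_top))
    calc ∫⁻ ω, ‖X s ω‖ₑ ∂P
        ≤ ENNReal.ofReal 1 + ENNReal.ofReal 1 * P {ω | 1 < |X s ω|} + ENNReal.ofReal (C / 1) :=
          lintegral_enorm_le_truncation P hXm.of_uncurry_left (hL2 s hs).integrable_sq (hC s hs)
            one_pos
      _ ≤ 1 + 1 + ENNReal.ofReal (C / 1) := by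
          rw [ENNReal.ofReal_one, one_mul]
          exact add_le_add_three le_rfl prob_le_one le_rfl
  filter_upwards [ae_lt_top hF_meas hfin] with ω hω
  exact ⟨(hXm.of_uncurry_right).aestronglyMeasurable, hasFiniteIntegral_iff_enorm.2 hω⟩

section Invariant

variable {Ω : Type*} [MeasurableSpace Ω] {μ : Measure Ω} {T Fs : Ω → Ω}

/-- **Deviation events along an a.e. modification of a measure-preserving map are at most the
static ones**: `μ {η < |Y (F z)|} ≤ μ {η < |Y w|}` if `F = T` a.e. and `T_# μ = μ`. [folklore] -/
theorem measure_event_comp_le (hT : Measurable T) (hinv : μ.map T = μ) (hF : ∀ᵐ z ∂μ, Fs z = T z)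
    (Y : Ω → ℝ) (η : ℝ) : μ {z | η < |Y (Fs z)|} ≤ μ {w | η < |Y w|} := by
  calc μ {z | η < |Y (Fs z)|} = μ {z | η < |Y (T z)|} := by
        refine measure_congr ?_
        filter_upwards [hF] with z hz
        simp only [eq_iff_iff]
        show η < |Y (Fs z)| ↔ η < |Y (T z)|
        rw [hz]
    _ ≤ μ.map T {w | η < |Y w|} := Measure.le_map_apply hT.aemeasurable _
    _ = _ := by rw [hinv]

/-- **Second moments along an a.e. modification of a measure-preserving map are the static ones**
(for measurable `Y`). [folklore] -/
theorem integral_sq_comp_eq (hT : Measurable T) (hinv : μ.map T = μ) (hF : ∀ᵐ z ∂μ, Fs z = T z)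
    {Y : Ω → ℝ} (hY : Measurable Y) : ∫ z, Y (Fs z) ^ 2 ∂μ = ∫ w, Y w ^ 2 ∂μ := by
  have h1 : ∫ z, Y (Fs z) ^ 2 ∂μ = ∫ z, Y (T z) ^ 2 ∂μ := by
    refine integral_congr_ae ?_
    filter_upwards [hF] with z hz
    simp only [hz]
  rw [h1, ← integral_map (f := fun w => Y w ^ 2) hT.aemeasurable
    ((hY.pow_const 2).aestronglyMeasurable), hinv]

/-- **Square integrability along an a.e. modification of a measure-preserving map.** [folklore] -/
theorem memLp_comp_of_map_eq (hT : Measurable T) (hinv : μ.map T = μ) (hF : ∀ᵐ z ∂μ, Fs z = T z)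
    {Y : Ω → ℝ} (hY : MemLp Y 2 μ) : MemLp (fun z => Y (Fs z)) 2 μ := by
  refine (hY.comp_measurePreserving ⟨hT, hinv⟩).ae_eq ?_
  filter_upwards [hF] with z hz
  simp only [Function.comp_apply, hz]

end Invariant

/-! ### Static second moments of one-particle empirical averages with cubic velocity tails -/

section Static

variable {N : ℕ} {μ : Measure (Cfg N)}

/-- The velocity envelope `m(v) = |v| + |v|² + |v|³` is in `L²` of the centred Maxwellian. -/
theorem memLp_two_envelope (θ : ℝ) :
    MemLp (fun v : V3 => ‖v‖ ^ 1 + ‖v‖ ^ 2 + ‖v‖ ^ 3) 2 (gaussMeasure (0 : V3) θ) :=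
  ((memLp_two_norm_pow_gaussMeasure_zero θ 1).add (memLp_two_norm_pow_gaussMeasure_zero θ 2)).add
    (memLp_two_norm_pow_gaussMeasure_zero θ 3)

/-- Pointwise domination of a one-particle empirical average by the velocity-envelope average:
`|(N+1)⁻¹ Σᵢ Z(zᵢ)| ≤ K (N+1)⁻¹ Σᵢ m(vᵢ)` when `|Z(x, v)| ≤ K m(v)`. [folklore] -/
theorem abs_avg_le_envelope {Z : T3 × V3 → ℝ} {K : ℝ}
    (hZm : ∀ y, |Z y| ≤ K * (‖y.2‖ ^ 1 + ‖y.2‖ ^ 2 + ‖y.2‖ ^ 3)) (w : Cfg N) :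
    |((N : ℝ) + 1)⁻¹ * ∑ i, Z (w i)| ≤
      K * (((N : ℝ) + 1)⁻¹ * ∑ i, (‖(w i).2‖ ^ 1 + ‖(w i).2‖ ^ 2 + ‖(w i).2‖ ^ 3)) := by
  have hc : (0 : ℝ) ≤ ((N : ℝ) + 1)⁻¹ := by positivity
  calc |((N : ℝ) + 1)⁻¹ * ∑ i, Z (w i)| = ((N : ℝ) + 1)⁻¹ * |∑ i, Z (w i)| := by
        rw [abs_mul, abs_of_nonneg hc]
    _ ≤ ((N : ℝ) + 1)⁻¹ * ∑ i, K * (‖(w i).2‖ ^ 1 + ‖(w i).2‖ ^ 2 + ‖(w i).2‖ ^ 3) :=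
        mul_le_mul_of_nonneg_left ((Finset.abs_sum_le_sum_abs _ _).trans
          (Finset.sum_le_sum fun i _ => hZm (w i))) hc
    _ = _ := by rw [← Finset.mul_sum]; ring

/-- **Square integrability of a centred one-particle empirical average** with cubic velocity
tails, on a probability space on which the envelope average is square integrable. [folklore] -/
theorem memLp_two_avg_sub_const (hμ : IsProbabilityMeasure μ) (hM : MemLp (fun w : Cfg N =>
      ((N : ℝ) + 1)⁻¹ * ∑ i, (‖(w i).2‖ ^ 1 + ‖(w i).2‖ ^ 2 + ‖(w i).2‖ ^ 3)) 2 μ)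
    {Z : T3 × V3 → ℝ} (hZ : Measurable Z) {K : ℝ}
    (hZm : ∀ y, |Z y| ≤ K * (‖y.2‖ ^ 1 + ‖y.2‖ ^ 2 + ‖y.2‖ ^ 3)) (l : ℝ) :
    MemLp (fun w : Cfg N => ((N : ℝ) + 1)⁻¹ * (∑ i, Z (w i)) - l) 2 μ := by
  refine MemLp.sub ?_ (memLp_const l)
  refine MemLp.of_le (hM.const_mul K) (measurable_const.mul (Finset.measurable_sum _
    fun i _ => hZ.comp (measurable_pi_apply i))).aestronglyMeasurable (ae_of_all _ fun w => ?_)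
  rw [Real.norm_eq_abs, Real.norm_eq_abs]
  exact (abs_avg_le_envelope hZm w).trans (le_abs_self _)

/-- **Second-moment bound for a centred one-particle empirical average** with cubic velocity
tails: `∫ ((N+1)⁻¹ Σᵢ Z(zᵢ) − l)² dμ ≤ 2K² A + 2L²` when `|Z(x, v)| ≤ K m(v)`, `|l| ≤ L` and the
envelope average has second moment at most `A` (pointwise Cauchy–Schwarz). [folklore] -/
theorem integral_sq_avg_sub_const_le (hμ : IsProbabilityMeasure μ) (hM : MemLp (fun w : Cfg N =>
      ((N : ℝ) + 1)⁻¹ * ∑ i, (‖(w i).2‖ ^ 1 + ‖(w i).2‖ ^ 2 + ‖(w i).2‖ ^ 3)) 2 μ) {A : ℝ}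
    (hA : ∫ w, (((N : ℝ) + 1)⁻¹ * ∑ i, (‖(w i).2‖ ^ 1 + ‖(w i).2‖ ^ 2 + ‖(w i).2‖ ^ 3)) ^ 2 ∂μ ≤ A)
    {Z : T3 × V3 → ℝ} {K L : ℝ} (hZm : ∀ y, |Z y| ≤ K * (‖y.2‖ ^ 1 + ‖y.2‖ ^ 2 + ‖y.2‖ ^ 3))
    {l : ℝ} (hl : |l| ≤ L) :
    ∫ w, (((N : ℝ) + 1)⁻¹ * (∑ i, Z (w i)) - l) ^ 2 ∂μ ≤ 2 * K ^ 2 * A + 2 * L ^ 2 := by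
  have hint := hM.integrable_sq
  calc ∫ w, (((N : ℝ) + 1)⁻¹ * (∑ i, Z (w i)) - l) ^ 2 ∂μ
      ≤ ∫ w, (2 * K ^ 2 * (((N : ℝ) + 1)⁻¹ *
          ∑ i, (‖(w i).2‖ ^ 1 + ‖(w i).2‖ ^ 2 + ‖(w i).2‖ ^ 3)) ^ 2 + 2 * L ^ 2) ∂μ := by
        refine integral_mono_of_nonneg (ae_of_all _ fun w => sq_nonneg _)
          ((hint.const_mul _).add (integrable_const _)) (ae_of_all _ fun w => ?_)
        have h1 := abs_le.1 (abs_avg_le_envelope hZm w)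
        have ha := sq_le_sq' h1.1 h1.2
        have hl2 := sq_le_sq' (abs_le.1 hl).1 (abs_le.1 hl).2
        nlinarith [sq_nonneg (((N : ℝ) + 1)⁻¹ * (∑ i, Z (w i)) + l)]
    _ = 2 * K ^ 2 * ∫ w, (((N : ℝ) + 1)⁻¹ *
          ∑ i, (‖(w i).2‖ ^ 1 + ‖(w i).2‖ ^ 2 + ‖(w i).2‖ ^ 3)) ^ 2 ∂μ + 2 * L ^ 2 := by
        rw [integral_add (hint.const_mul _) (integrable_const _), integral_const_mul,
          integral_const]
        simp
    _ ≤ _ := by gcongr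

end Static

/-! ### The one-particle integrand: joint continuity and cubic velocity envelope -/

/-- A field jointly smooth on `[0, t] × 𝕋³`, reparametrised in time through the continuous
retraction `projIcc 0 t : ℝ → [0, t]`, is jointly continuous on all of `ℝ × 𝕋³`. [folklore] -/
theorem continuous_comp_projIcc {F : Type*} [NormedAddCommGroup F] [NormedSpace ℝ F] {t : ℝ}
    {u : ℝ → T3 → F} (ht : 0 < t) (hu : Torus.IsSmoothSpaceTimeOn (Icc 0 t) u) :
    Continuous fun q : ℝ × T3 => u (projIcc 0 t ht.le q.1) q.2 := by
  have h2 : Continuous fun q : ℝ × T3 => ((projIcc 0 t ht.le q.1 : ℝ), q.2) :=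
    (continuous_subtype_val.comp (continuous_projIcc.comp continuous_fst)).prodMk continuous_snd
  exact (Literature.Analysis.FluidPDE.Torus.continuousOn_uncurry_of_continuousOn_stLift
    hu.continuousOn_stLift).comp_continuous h2 fun q => mk_mem_prod (projIcc 0 t _ q.1).2 trivial

/-- Joint continuity of the one-particle integrand built from four jointly continuous weights. -/
theorem continuous_ccIntegrand {f1 f4 : ℝ → T3 → V3} {f2 : ℝ → T3 → ℝ} {f3 : Fin 3 → ℝ → T3 → V3}
    (h1 : Continuous fun q : ℝ × T3 => f1 q.1 q.2) (h2 : Continuous fun q : ℝ × T3 => f2 q.1 q.2)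
    (h3 : ∀ a, Continuous fun q : ℝ × T3 => f3 a q.1 q.2)
    (h4 : Continuous fun q : ℝ × T3 => f4 q.1 q.2) :
    Continuous fun q : ℝ × (T3 × V3) =>
      ((∑ j, f1 q.1 q.2.1 j * q.2.2 j) + f2 q.1 q.2.1 * (‖q.2.2‖ ^ 2 / 2)) +
      ((∑ a, ∑ b, f3 a q.1 q.2.1 b * q.2.2 a * q.2.2 b) +
        (∑ a, f4 q.1 q.2.1 a * q.2.2 a) * (‖q.2.2‖ ^ 2 / 2)) := by
  fun_prop

/-- Cubic velocity envelope for the one-particle integrand with weights bounded by `C`. -/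
theorem abs_ccIntegrand_le {f1 : T3 → V3} {f2 : T3 → ℝ} {G : T3 → Fin 3 → Fin 3 → ℝ} {g : T3 → V3}
    {C : ℝ} (hC : 0 ≤ C) (h1 : ∀ x, ‖f1 x‖ ≤ C) (h2 : ∀ x, ‖f2 x‖ ≤ C) (h3 : ∀ x a b, |G x a b| ≤ C)
    (h4 : ∀ x a, |g x a| ≤ C) (x : T3) (v : V3) :
    |((∑ j, f1 x j * v j) + f2 x * (‖v‖ ^ 2 / 2)) +
        ((∑ a, ∑ b, G x a b * v a * v b) + (∑ a, g x a * v a) * (‖v‖ ^ 2 / 2))| ≤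
      16 * C * (‖v‖ ^ 1 + ‖v‖ ^ 2 + ‖v‖ ^ 3) := by
  have hv := norm_nonneg v
  have hcomp : ∀ (w : V3) (j : Fin 3), |w j| ≤ ‖w‖ := fun w j => by
    rw [← Real.norm_eq_abs]; exact PiLp.norm_apply_le w j
  -- `|Σ_j c_j v_j| ≤ 3 D |v|` whenever `|c_j| ≤ D`
  have hlin : ∀ {c : Fin 3 → ℝ} {D : ℝ}, (∀ j, |c j| ≤ D) → |∑ j, c j * v j| ≤ 3 * (D * ‖v‖) := by
    intro c D hc
    have hD : 0 ≤ D := (abs_nonneg _).trans (hc 0)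
    calc |∑ j, c j * v j| ≤ ∑ j, |c j * v j| := Finset.abs_sum_le_sum_abs _ _
      _ ≤ ∑ j : Fin 3, D * ‖v‖ := Finset.sum_le_sum fun j _ => by
          rw [abs_mul]; exact mul_le_mul (hc j) (hcomp v j) (abs_nonneg _) hD
      _ = 3 * (D * ‖v‖) := by simp
  have hA1 : |∑ j, f1 x j * v j| ≤ 3 * (C * ‖v‖) := hlin fun j => (hcomp _ j).trans (h1 x)
  have hA2 : |f2 x * (‖v‖ ^ 2 / 2)| ≤ C * (‖v‖ ^ 2 / 2) := by
    rw [abs_mul, abs_of_nonneg (by positivity : (0 : ℝ) ≤ ‖v‖ ^ 2 / 2)]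
    exact mul_le_mul_of_nonneg_right ((Real.norm_eq_abs _).symm.trans_le (h2 x)) (by positivity)
  have hB1 : |∑ a, ∑ b, G x a b * v a * v b| ≤ 3 * (3 * (C * ‖v‖ * ‖v‖)) := by
    refine (Finset.abs_sum_le_sum_abs _ _).trans ((Finset.sum_le_sum fun a _ =>
      hlin (D := C * ‖v‖) fun b => ?_).trans (by simp))
    rw [abs_mul]
    exact mul_le_mul (h3 x a b) (hcomp v a) (abs_nonneg _) hC
  have hB2 : |(∑ a, g x a * v a) * (‖v‖ ^ 2 / 2)| ≤ 3 * (C * ‖v‖) * (‖v‖ ^ 2 / 2) := by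
    rw [abs_mul, abs_of_nonneg (by positivity : (0 : ℝ) ≤ ‖v‖ ^ 2 / 2)]
    exact mul_le_mul_of_nonneg_right (hlin (h4 x)) (by positivity)
  calc _ ≤ (3 * (C * ‖v‖) + C * (‖v‖ ^ 2 / 2)) +
        (3 * (3 * (C * ‖v‖ * ‖v‖)) + 3 * (C * ‖v‖) * (‖v‖ ^ 2 / 2)) :=
        (abs_add_le _ _).trans (add_le_add ((abs_add_le _ _).trans (add_le_add hA1 hA2))
          ((abs_add_le _ _).trans (add_le_add hB1 hB2)))
    _ ≤ 16 * C * (‖v‖ ^ 1 + ‖v‖ ^ 2 + ‖v‖ ^ 3) := by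
        nlinarith [mul_nonneg hC hv, mul_nonneg hC (pow_nonneg hv 2),
          mul_nonneg hC (pow_nonneg hv 3)]

/-! ### The registered stub -/

/-- **Registered stub `cc_timeIntegral_tendsto_const`** of crux stmt-AtomisticToContinuum-9518
(line hemisphere-affine-slaving, equilibrium rung, `Cc` side: the time-integral part). Under the
homogeneous local Gibbs law at temperature `θ > 0`, `σ ≤ 1/2` (probability measures satisfying the
density law of large numbers), for space–time tests `ψ, χ` smooth on `[0, t]`, `τ ∈ [0, t]` and
`δ > 0`, the time integral over `[0, τ]` of `O_{∂ψ,∂χ}(s, Φ_s z) + d/dr|₀ O(s, S_r Φ_s z)`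
concentrates at `(3θ/2)(∫ χ_τ − ∫ χ_0)` (one-time laws of large numbers along the stationary flow,
uniform second moments, `tendsto_measure_setIntegral_of_forall`, FTC in time). [folklore] -/
theorem cc_timeIntegral_tendsto_const : ∀ {σ θ : ℝ}, 0 < θ → σ ≤ 1 / 2 → ∀ (Φ : Flows σ), (∀ N, IsProbabilityMeasure (Literature.MathematicalPhysics.KineticTheory.localGibbsLaw σ (fun _ => 1) (fun _ => 0) (fun _ => θ) N (Φ N))) → (∀ f : T3 → ℝ, Continuous f → ∀ δ : ℝ, 0 < δ → Tendsto (fun N : ℕ => Literature.MathematicalPhysics.KineticTheory.localGibbsLaw σ (fun _ => 1) (fun _ => 0) (fun _ => θ) N (Φ N) {z | δ < |Literature.MathematicalPhysics.KineticTheory.empiricalDensityField z f - ∫ x, f x|}) atTop (𝓝 0)) → ∀ {t : ℝ}, 0 < t → ∀ {ψ : ℝ → T3 → V3} {χ : ℝ → T3 → ℝ}, Literature.Analysis.FunctionSpaces.Torus.IsSmoothSpaceTimeOn (Icc 0 t) ψ → Literature.Analysis.FunctionSpaces.Torus.IsSmoothSpaceTimeOn (Icc 0 t) χ → ∀ τ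 ∈ Icc 0 t, ∀ δ : ℝ, 0 < δ → Tendsto (fun N : ℕ => Literature.MathematicalPhysics.KineticTheory.localGibbsLaw σ (fun _ => 1) (fun _ => 0) (fun _ => θ) N (Φ N) {z | δ < |(∫ s in Icc 0 τ, (Obs (Literature.Analysis.FunctionSpaces.Torus.timeDeriv ψ) (Literature.Analysis.FunctionSpaces.Torus.timeDeriv χ) N s ((Φ N).flow s z) + deriv (fun r : ℝ => Obs ψ χ N s (Literature.Analysis.FluidPDE.freeFlight (Literature.Analysis.FluidPDE.Torus.geometry (Fin 3)) r ((Φ N).flow s z))) 0)) - 3 * θ / 2 * ((∫ x, χ τ x) - ∫ x, χ 0 x)|}) atTop (𝓝 0) := by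
  intro σ θ hθ hσ Φ hP hL t ht ψ χ hψ hχ τ hτ δ hδ
  have hU : UniqueDiffOn ℝ (Icc 0 t) := uniqueDiffOn_Icc ht
  have hIoo : ∀ {s}, s ∈ Ioo 0 τ → s ∈ Icc 0 t := fun hs => ⟨hs.1.le, hs.2.le.trans hτ.2⟩
  have hint : ∀ {s}, s ∈ Ioo 0 τ → s ∈ interior (Icc 0 t) := fun hs => by
    rw [interior_Icc]; exact ⟨hs.1, hs.2.trans_le hτ.2⟩
  have hpm : ∀ s, (projIcc 0 t ht.le s : ℝ) ∈ Icc 0 t := fun s => (projIcc 0 t ht.le s).2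
  have hpI : ∀ {s}, s ∈ Icc 0 t → (projIcc 0 t ht.le s : ℝ) = s := fun hs => by
    rw [projIcc_of_mem ht.le hs]
  -- the four smooth weight fields `∂ₛψ, ∂ₛχ, ∇ψ_a, ∇χ` and a common uniform bound `C`
  have hdψs := hψ.timeDerivWithin hU
  have hdχs := hχ.timeDerivWithin hU
  have hgψs : ∀ a : Fin 3, Torus.IsSmoothSpaceTimeOn (Icc 0 t)
      (fun s => Torus.gradient (fun y => ψ s y a)) := fun a => (hψ.apply a).gradient hU
  have hgχs := hχ.gradient hU
  obtain ⟨C1, hC1₀, hC1⟩ := exists_norm_timeDerivWithin_le ht hψ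
  obtain ⟨C2, hC2₀, hC2⟩ := exists_norm_timeDerivWithin_le ht hχ
  obtain ⟨C3, hC3₀, hC3, hC4⟩ := exists_grad_bound ht hψ hχ
  have hC₀ : 0 ≤ C1 + C2 + C3 := by positivity
  -- the one-particle integrand `Z` and the centring `ℓ`
  obtain ⟨Z, hZ⟩ : ∃ Z : ℝ → T3 × V3 → ℝ, ∀ s y, Z s y =
    ((∑ j, Torus.timeDerivWithin (Icc 0 t) ψ (projIcc 0 t ht.le s) y.1 j * y.2 j) +
      Torus.timeDerivWithin (Icc 0 t) χ (projIcc 0 t ht.le s) y.1 * (‖y.2‖ ^ 2 / 2)) +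
    ((∑ a, ∑ b, gradPsi ψ (projIcc 0 t ht.le s) y.1 a b * y.2 a * y.2 b) +
      (∑ a, gradChi χ (projIcc 0 t ht.le s) y.1 a * y.2 a) * (‖y.2‖ ^ 2 / 2)) := ⟨_, fun _ _ => rfl⟩
  have hZc : Continuous (uncurry Z) := by
    have h := continuous_ccIntegrand
      (f1 := fun s x => Torus.timeDerivWithin (Icc 0 t) ψ (projIcc 0 t ht.le s) x)
      (f2 := fun s x => Torus.timeDerivWithin (Icc 0 t) χ (projIcc 0 t ht.le s) x)
      (f3 := fun a s x => Torus.gradient (fun y => ψ (projIcc 0 t ht.le s) y a) x)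
      (f4 := fun s x => Torus.gradient (χ (projIcc 0 t ht.le s)) x)
      (continuous_comp_projIcc ht hdψs) (continuous_comp_projIcc ht hdχs)
      (fun a => continuous_comp_projIcc ht (hgψs a)) (continuous_comp_projIcc ht hgχs)
    simpa only [hZ, Function.uncurry_def, gradPsi, gradChi] using h
  have hZb : ∀ s y, |Z s y| ≤ 16 * (C1 + C2 + C3) * (‖y.2‖ ^ 1 + ‖y.2‖ ^ 2 + ‖y.2‖ ^ 3) :=
      fun s y => by
    rw [hZ]
    exact abs_ccIntegrand_le hC₀ (fun x => (hC1 _ (hpm s) x).trans (by linarith))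
      (fun x => (hC2 _ (hpm s) x).trans (by linarith))
      (fun x a b => (hC3 _ (hpm s) x a b).trans (by linarith))
      (fun x a => (hC4 _ (hpm s) x a).trans (by linarith)) y.1 y.2
  have hZsm : ∀ s, Measurable (Z s) := fun s => hZc.measurable.of_uncurry_left
  obtain ⟨ℓ, hℓ⟩ : ∃ ℓ : ℝ → ℝ, ∀ s,
      ℓ s = 3 * θ / 2 * ∫ x, Torus.timeDerivWithin (Icc 0 t) χ (projIcc 0 t ht.le s) x :=
    ⟨_, fun _ => rfl⟩
  have hℓc : Continuous ℓ := by
    rw [show ℓ = _ from funext hℓ]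
    exact continuous_const.mul ((hdχs.continuousOn_integral (convex_Icc 0 t)).comp_continuous
      (continuous_subtype_val.comp continuous_projIcc) fun s => (projIcc 0 t ht.le s).2)
  have hLℓ : ∀ s, |ℓ s| ≤ 3 * θ / 2 * C2 := fun s => by
    rw [hℓ, abs_mul, abs_of_pos (by positivity : (0 : ℝ) < 3 * θ / 2)]
    refine mul_le_mul_of_nonneg_left ?_ (by positivity)
    simpa using norm_integral_le_of_norm_le_const (ae_of_all (volume : Measure T3)
      fun x => hC2 _ (hpm s) x)
  have hℓI : ∫ s in Icc 0 τ, ℓ s = 3 * θ / 2 * ((∫ x, χ τ x) - ∫ x, χ 0 x) := by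
    rw [integral_slice_sub_eq_setIntegral_timeDeriv ht hχ τ hτ, ← integral_const_mul,
      integral_Icc_eq_integral_Ioo, integral_Icc_eq_integral_Ioo]
    refine setIntegral_congr_fun measurableSet_Ioo fun s hs => ?_
    simp only [hℓ, hpI (hIoo hs)]
    congr 1
    exact integral_congr_ae (ae_of_all _ fun x => Torus.timeDerivWithin_of_mem_interior (hint hs) x)
  -- the process `X`, through a jointly measurable modification `F` of the flow
  choose F hFm hF using fun N => exists_measurable_flow Φ N
  have hgood : ∀ N, ∀ᵐ z ∂(localGibbsLaw σ (fun _ => 1) (fun _ => 0) (fun _ => θ) N (Φ N)),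
      z ∈ (Φ N).good := fun N => ae_iff.2 (localGibbsLaw_compl_good' (Φ N))
  have hFae : ∀ N s, ∀ᵐ z ∂(localGibbsLaw σ (fun _ => 1) (fun _ => 0) (fun _ => θ) N (Φ N)),
      F N (s, z) = (Φ N).flow s z := fun N s => (hgood N).mono fun z hz => hF N s z hz
  have hinv := fun N s => map_flow_localGibbsLaw_const σ 1 θ 0 N (Φ N) s
  obtain ⟨X, hX⟩ : ∃ X : (N : ℕ) → ℝ → Cfg N → ℝ, ∀ N s, X N s = fun z =>
      ((N : ℝ) + 1)⁻¹ * (∑ i, Z s (F N (s, z) i)) - ℓ s := ⟨_, fun _ _ => rfl⟩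
  -- (i) joint measurability
  have hXm : ∀ N, Measurable (uncurry (X N)) := by
    intro N
    have h : Measurable fun q : ℝ × Cfg N => ((N : ℝ) + 1)⁻¹ * (∑ i, Z q.1 (F N q i)) - ℓ q.1 := by
      refine Measurable.sub (measurable_const.mul (Finset.measurable_sum _ fun i _ => ?_))
        (hℓc.measurable.comp measurable_fst)
      exact hZc.measurable.comp (measurable_fst.prodMk ((measurable_pi_apply i).comp (hFm N)))
    simpa only [hX, Function.uncurry_def] using h
  -- (ii) square integrability of the slices, (iii) second moments bounded uniformly in `(N, s)`
  have hM := fun N => memLp_two_velAvg_localGibbsLaw_const one_pos hθ hσ 0 Φ N _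
    (memLp_two_envelope θ)
  have hA := fun N => integral_velAvg_sq_le_localGibbsLaw_const one_pos hθ hσ 0 Φ N _
    (memLp_two_envelope θ)
  have hXL2 : ∀ N, ∀ s ∈ Icc 0 τ, MemLp (X N s) 2
      (localGibbsLaw σ (fun _ => 1) (fun _ => 0) (fun _ => θ) N (Φ N)) := fun N s _ => by
    rw [hX]
    exact memLp_comp_of_map_eq ((Φ N).measurable_flow s) (hinv N s) (hFae N s)
      (memLp_two_avg_sub_const (hP N) (hM N) (hZsm s) (hZb s) (ℓ s))
  have hXC : ∀ N, ∀ s ∈ Icc 0 τ, ∫ z, X N s z ^ 2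
      ∂(localGibbsLaw σ (fun _ => 1) (fun _ => 0) (fun _ => θ) N (Φ N)) ≤
      2 * (16 * (C1 + C2 + C3)) ^ 2 * ∫ v, (‖v‖ ^ 1 + ‖v‖ ^ 2 + ‖v‖ ^ 3) ^ 2
        ∂(gaussMeasure (0 : V3) θ) + 2 * (3 * θ / 2 * C2) ^ 2 := fun N s _ => by
    simp only [hX]
    exact (integral_sq_comp_eq ((Φ N).measurable_flow s) (hinv N s) (hFae N s)
      ((measurable_const.mul (Finset.measurable_sum _ fun i _ => (hZsm s).comp
        (measurable_pi_apply i))).sub measurable_const)).trans_le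
      (integral_sq_avg_sub_const_le (hP N) (hM N) (hA N) (hZb s) (hLℓ s))
  -- (iv) convergence in probability of each slice, `s ∈ [0, τ]`
  have hXlim : ∀ s ∈ Icc 0 τ, ∀ η : ℝ, 0 < η → Tendsto (fun N : ℕ =>
      localGibbsLaw σ (fun _ => 1) (fun _ => 0) (fun _ => θ) N (Φ N) {z | η < |X N s z|})
      atTop (𝓝 0) := by
    intro s hs η hη
    have hs' : s ∈ Icc 0 t := ⟨hs.1, hs.2.trans hτ.2⟩
    have hO := obs_lln_const hθ Φ hP hL (Torus.timeDerivWithin (Icc 0 t) ψ s)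
      (Torus.timeDerivWithin (Icc 0 t) χ s) (hdψs.isSmooth_slice hs').continuous
      (hdχs.isSmooth_slice hs').continuous
    have hgc : ∀ a b, Continuous fun x => gradPsi ψ s x a b := fun a b => by
      have h := ((hgψs a).isSmooth_slice hs').continuous
      simp only [gradPsi]; fun_prop
    have hB := stream_lln_const hθ Φ hP hL (gradPsi ψ s) (gradChi χ s) hgc
      (hgχs.isSmooth_slice hs').continuous
    have hstat : Tendsto (fun N : ℕ => localGibbsLaw σ (fun _ => 1) (fun _ => 0) (fun _ => θ) N
        (Φ N) {w | η < |((N : ℝ) + 1)⁻¹ * (∑ i, Z s (w i)) - ℓ s|}) atTop (𝓝 0) := by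
      refine (tendsto_measure_lt_abs_add_of_forall hO hB η hη).congr fun N => ?_
      congr 1
      ext w
      simp only [mem_setOf_eq]
      apply iff_of_eq
      congr 2
      rw [integral_sum_gradPsi_diag_eq_zero (hψ.isSmooth_slice hs'), mul_zero, sub_zero]
      simp only [hZ, hℓ, hpI hs', Finset.sum_add_distrib, mul_add]
      ring
    refine tendsto_of_tendsto_of_tendsto_of_le_of_le tendsto_const_nhds hstat
      (fun N => zero_le) fun N => ?_
    simp only [hX]
    exact measure_event_comp_le ((Φ N).measurable_flow s) (hinv N s) (hFae N s)
      (fun w => ((N : ℝ) + 1)⁻¹ * (∑ i, Z s (w i)) - ℓ s) η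
  -- the time-integral lemma, and identification with the crux's time integral on good paths
  have hmain := tendsto_measure_setIntegral_of_forall
    (fun N => localGibbsLaw σ (fun _ => 1) (fun _ => 0) (fun _ => θ) N (Φ N)) hP hτ.1 X hXm hXL2
    hXC hXlim δ hδ
  have hT : ∀ N, ∀ z ∈ (Φ N).good,
      ∫ s in Icc 0 τ, (Obs (Torus.timeDeriv ψ) (Torus.timeDeriv χ) N s ((Φ N).flow s z) +
        deriv (fun r : ℝ => Obs ψ χ N s (freeFlight (Torus.geometry (Fin 3)) r ((Φ N).flow s z))) 0)
        = ∫ s in Icc 0 τ, (X N s z + ℓ s) := by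
    intro N z hz
    rw [integral_Icc_eq_integral_Ioo, integral_Icc_eq_integral_Ioo]
    refine setIntegral_congr_fun measurableSet_Ioo fun s hs => ?_
    rw [deriv_Obs_freeFlight_eq hψ hχ N _ (hIoo hs), BalanceIdentity.Obs_eq_sum]
    simp only [hX, hZ, hF N s z hz, hpI (hIoo hs), sub_add_cancel, Finset.sum_add_distrib,
      ← Torus.timeDerivWithin_of_mem_interior (hint hs), mul_add]
  refine tendsto_of_tendsto_of_tendsto_of_le_of_le tendsto_const_nhds hmain (fun N => zero_le)
    fun N => measure_mono_ae ?_
  haveI := hP N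
  filter_upwards [hgood N, ae_integrableOn_Icc_of_sq_le _ (hXm N) (hXL2 N) (hXC N)] with z hz hzi
  intro hzE
  replace hzE : δ < |_ - 3 * θ / 2 * ((∫ x, χ τ x) - ∫ x, χ 0 x)| := hzE
  rw [hT N z hz, integral_add hzi hℓc.integrableOn_Icc, hℓI, add_sub_cancel_right] at hzE
  exact hzE

end

end Summit.AtomisticToContinuum.HydrodynamicLimit.Theorems.HemisphereAffineSlaving
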